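import Literature.NumberTheory.EllipticCurves.KrizLi2019.TwoPartBSDTwists
import Literature.NumberTheory.EllipticCurves.Zhai2021.TwoAdicLowerBoundTwists
import HarnessLib

/-!
# Kriz–Li 2019 (FMS 7, e15), §6 Table 2 («Assumption (★) for rank zero curves») — the rows `44a1` and
# `92a1` AS PRINTED: for the optimal curves `E = 44a1`, `E = 92a1` and `K = ℚ(√−7)`, Assumption (★)
# holds (statement-only named facts; the per-curve input of Thm 5.1 (2) = `thm112_bsdTwo_twist` at the
# two bases of the table that are ADDITIVE at `2` with `49·N < 5000`)

HONEST FRAMING (cell `bsd-2adic`, seat `bsd-2adic-k4-w2` GEN 7, K4 crux `AdditiveRankZeroAtTwo` 19098,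
children C3″ 22617 / C1″ 22615; 2026-08-29): two PUBLISHED per-curve computational assertions (check-marks
in a table of a refereed paper) vendored as named `Prop`s — nothing asserted, nothing discharged
(D-0014) — with a locator into the held source. They are the only non-kernel, non-theorem inputs of the
Kriz–Li road on the quadratic-twist families `{44a1^{(d)}, 44a1^{(−7d)}}` and `{92a1^{(d)}, 92a1^{(−7d)}}`,
`d ∈ 𝒩(E, ℚ(√−7))`, `χ_d(−N) = 1` (Summits consumer
`Summits/BirchSwinnertonDyer/BirchSwinnertonDyer/Theorems/ByReductionTypeAtTwoAdditivePotGoodPrintKrizLi*.lean`):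
Assumption (★) is a statement about the `2`-adic formal logarithm of the Heegner point, which the
kernel cannot evaluate. Everything else the consumer needs about the two rows is decided IN THE KERNEL
there (`E(ℚ)[2] = 0`, the Heegner hypothesis for `(N, ℚ(√−7))`, `c₂(E) = 3` odd via the Kodaira type
`IV*` resp. `IV` at `2` by a Tate certificate, `N = 44` resp. `N = 92` exactly, additivity and
`0 ≤ ord₂ j`, non-CM, irreducibility of `E[2]`) or taken BY NAME from print (`BSD(E, 2)` and
`BSD(E^{(−7)}, 2)` from Creutz–Miller 2012 / Miller 2011, conductors `44, 2156, 92, 4508 < 5000`; the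
odd Manin constant of an optimal curve of level `≤ 130000` from Agashe–Ribet–Stein 2006 Thm. 2.6).
Nothing is booked here; BSD is not proved by any of this.

Source. D. Kriz, C. Li, *Goldfeld's conjecture and congruences between Heegner points*, Forum Math.
Sigma **7** (2019), e15, doi:10.1017/fms.2019.9 [KrizLi2019] = arXiv:1606.03172 (§§1–6). Texts read:
the held chunk texts `paper:doi-10-1017-fms-2019-9` (p0018 L17: Example 6.5) and `paper:arxiv-1606.03172`
(p0020 L2), which both DROP the table body; the table itself was read in the arXiv **v3** e-print source
`Congruence.tex` (copy kept by the cell `bsd-print-cf2` at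
`run/shared/lean/pub/bsd-print-cf2/lit/krizli2019/arXiv-1606.03172v3-Congruence.tex`), lines 1036–1084
(`\label{tab:2}`, Example 6.5), rows at lines 1045 (`44a1`) and 1047 (`92a1`).

## The printed statement (verbatim)

* Example 6.5 (tex l. 1037; FMS p0018 L17): "For rank zero curves, the computation of Heegner points is
  most feasible when `|d_K|` is small. Thus we fix `d_K = −7` and search for rank zero optimal curves with
  `E(ℚ)[2] = 0` satisfying the two necessary conditions in Example 6.2 and such that `K = ℚ(√−7)`
  satisfies the Heegner hypothesis. There are 39 such curves of conductor `≤ 750`. See Table 2. Then 28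
  out of 39 curves satisfy (★), in which case Theorems 4.3, 1.12 apply and the improved bound towards
  Goldfeld's conjecture holds. If `c₂(E)` is further odd (true for 24 out of 28), then the application to
  BSD(2) (Theorem 5.1) also applies."
* Table 2, caption "Assumption (★) for rank zero curves", header `E | d_K | c₂(E) | ★`, rows (tex
  l. 1043–1055, first block): "`11a1 & -7 & 1 & ✓`", "`37b1 & -7 & 1 & ✓`", "**`44a1 & -7 & 3 & ✓`**",
  "`67a1 & -7 & 1 & ✓`", "**`92a1 & -7 & 3 & ✓`**", "`116a1 & -7 & 3 &`", "`116b1 & -7 & 3 &`",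
  "`176a1 & -7 & 1 & ✓`", … (39 rows in all; 28 check-marks).
* (★) itself (Thm 1.4 / Thm 4.3 / Thm 5.1): "`2` splits in `K` and `|Ẽ^{ns}(𝔽₂)| · log_{ω_E}(P) / 2 ≢ 0
  (mod 2)`", `P ∈ E(K)` the Heegner point of the fixed modular parametrisation `π_E : X₀(N) → E`, `ω_E`
  with `π_E^* ω_E = f(q) dq/q` (§1, arXiv p0003 L30–L38); Thm 5.1 (2) = Thm 1.12: "If `E` has additive
  reduction at `2`, further assume its Manin constant is odd."
* The example following Thm 1.12 for the first row (Example 6.4, `E = 11a1`, FMS p0018 L17): "Since BSD(2)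
  is true for `E/ℚ` and `E^{(−7)}/ℚ` by numerical verification, it follows from Theorem 5.1 that the BSD(2)
  is true for `E^{(d)}` and `E^{(−7d)}`" — the use the consumer makes of the two rows below (with Miller's
  verification range `N < 5000`: `44·49 = 2156`, `92·49 = 4508`).

## Transcription (tree dictionary of `KrizLi2019/TwoPartBSDTwists.lean`, binders of `thm112_bsdTwo_twist`)

`E = 44a1` = Cremona's globally minimal model `[0, 1, 0, 3, −1]` (`y² = x³ + x² + 3x − 1`; `Δ = −2816 =
−2⁸·11`, `c₄ = −128`, `j = 2¹³/11`, conductor `44`, Kodaira `IV*, I₁`, `c_p = (3, 1)`, `E(ℚ) ≅ ℤ/3`, `r = 0`;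
Cremona 1992 Table 1 p. 106 «44 A1(A)»); `E = 92a1` = `[0, 1, 0, 2, 1]` (`y² = x³ + x² + 2x + 1`;
`Δ = −368 = −2⁴·23`, `c₄ = −80`, `j = 2⁸·5³/23`, conductor `92`, Kodaira `IV, I₁`, `c_p = (3, 1)`,
`E(ℚ) ≅ ℤ/3` generated by `(0, 1)`, `r = 0`; Table 1 p. 134 «92 A1(A)»). "`K = ℚ(√−7)`" = any number field
`K` with `IsImaginaryQuadratic K` and `NumberField.discr K = −7`. "Optimal curve" with "the fixed modular
parametrisation `π_E`" = a parametrisation datum `Dt : ModularParametrizationData E N` at the conductor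
level `N = conductorNorm` (its `NeZero` witness packed in the statement, as in
`ShuZhai2021.table52_row36a1` / `KrizLi2019.table1_row243a1`) satisfying the lattice equality
`Zhai2021.IsOptimalDatum E Dt` (`Λ_E = c·Λ_f`, the tree's rendering of `X₀(N)`-optimality, exactly the
displayed binder of the cell's Zhai / Shu–Zhai roads) — transcribed because Thm 5.1 (2) needs «Manin
constant odd» for these two ADDITIVE curves, which the consumer derives from optimality by print
(Agashe–Ribet–Stein Thm. 2.6, level `≤ 130000`), not from this fact. "(★) holds for the Heegner point" =
there are a Heegner datum `H : HeegnerDatum N (discr K)`, an embedding `ι : K →+* ℂ`, a point `P ∈ E(K)`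
mapping to `heegnerPointComplex Dt H`, and an embedding `j : K →ₐ[ℚ] ℚ₂` with `AssumptionStar E Dt K P j`
— exactly the binders `Dt, H, ι, P, (P ↦ heegnerPointComplex), j, AssumptionStar` of
`thm112_bsdTwo_twist` / `thm33_rank_twist`, so that the consumer instantiates those theorems at
`W = 44a1`, `92a1` with no further gloss. Global minimality of the printed model (needed to state
`AssumptionStar`) is a binder `[IsGloballyMinimal]` of the fact, discharged by the consumer's kernel
certificate (Kraus), so nothing about the model is re-proved here. The other printed columns are
kernel-side or print-side in the consumer and NOT transcribed: "rank zero" (caption; the consumer needs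
only `r_an ≤ 1`, which is Thm 4.3 at `d = 1`, and displays Cremona's `r = 0` where the K4 sorting wants
it), "`E(ℚ)[2] = 0`", "`c₂(E) = 3`" (Tate's algorithm, type `IV*` / `IV` at `2`), the Heegner hypothesis.
Nothing weaker or stronger is transcribed; no `_holds` is expected (it needs the `2`-adic logarithm of an
explicit Heegner point over `ℚ(√−7)`). Status: PUB (refereed); per-curve computational TABLE entries,
flag word for the referee: TABLE.

## References
* [KrizLi2019] §6 Example 6.5 and Table 2 (rows 44a1, 92a1) (FMS chunk p0018 L17; arXiv:1606.03172v3
  `Congruence.tex` ll. 1037, 1040–1084, rows ll. 1045 / 1047); Assumption (★) (arXiv p0003 L45–L48);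
  Thm 5.1 (2) = arXiv Thm 1.12 (p0004 L32–L42); Example 6.4 (FMS p0018 L17).
* [CremonaAlgorithms1997] Table 1 (curves 44A1 = `[0,1,0,3,−1]`, 92A1 = `[0,1,0,2,1]`, the
  `Γ₀(N)`-optimal curves of their classes; held scan pp. 106, 134).
* [Zhai2021BSDExactFormulaTwists] §1 (the optimality predicate `IsOptimalDatum`).
-/

noncomputable section

open scoped Classical

open NumberField WeierstrassCurve Literature.NumberTheory.EllipticCurves
  Literature.NumberTheory.EllipticCurves.ModularForms

namespace Literature.NumberTheory.EllipticCurves.KrizLi2019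

/-- **Kriz–Li 2019, §6 Table 2, row `44a1`** (verbatim in the module docstring: `44a1 | d_K = −7 |
c₂(E) = 3 | ★ ✓`; Example 6.5 "rank zero optimal curves … `K = ℚ(√−7)`"): for every imaginary quadratic
field `K` of discriminant `−7`, the optimal curve `44a1` on its (globally minimal) model `[0,1,0,3,−1]`
admits an OPTIMAL modular parametrisation datum `Dt` at level `N(E)` (`Zhai2021.IsOptimalDatum`), a
Heegner datum `H` of discriminant `d_K` and level `N(E)`, an embedding `ι : K → ℂ`, a point `P ∈ E(K)`
mapping to the Heegner point `heegnerPointComplex Dt H`, and an embedding `j : K → ℚ₂`, such that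
Assumption (★) `AssumptionStar E Dt K P j` holds — i.e. exactly the hypotheses `Dt, H, ι, P, hP, j, (★)`
of `thm112_bsdTwo_twist` at `W = [0,1,0,3,−1]`. Statement only; TABLE entry (a `2`-adic logarithm
computation) in a refereed paper; no `_holds` expected.
[cite: KrizLi2019, §6 Table 2 (row 44a1) and Example 6.5 (FMS 7 (2019) e15, chunk p0018 L17; arXiv:1606.03172v3 Congruence.tex ll. 1037, 1045)] -/
def table2_row44a1 : Prop :=
  ∀ [(⟨0, 1, 0, 3, -1⟩ : WeierstrassCurve ℚ).IsGloballyMinimal]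
    (K : Type) [Field K] [NumberField K], IsImaginaryQuadratic K → NumberField.discr K = -7 →
    ∃ (_ : NeZero ((⟨0, 1, 0, 3, -1⟩ : WeierstrassCurve ℚ).conductorNorm ℤ))
      (Dt : ModularParametrizationData (⟨0, 1, 0, 3, -1⟩ : WeierstrassCurve ℚ)
        ((⟨0, 1, 0, 3, -1⟩ : WeierstrassCurve ℚ).conductorNorm ℤ))
      (H : HeegnerDatum ((⟨0, 1, 0, 3, -1⟩ : WeierstrassCurve ℚ).conductorNorm ℤ) (NumberField.discr K))
      (ι : K →+* ℂ) (P : ((⟨0, 1, 0, 3, -1⟩ : WeierstrassCurve ℚ).baseChange K).toAffine.Point)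
      (j : K →ₐ[ℚ] ℚ_[2]),
      Zhai2021.IsOptimalDatum (⟨0, 1, 0, 3, -1⟩ : WeierstrassCurve ℚ) Dt ∧
        WeierstrassCurve.Affine.Point.map ι.toRatAlgHom P = heegnerPointComplex Dt H ∧
          AssumptionStar (⟨0, 1, 0, 3, -1⟩ : WeierstrassCurve ℚ) Dt K P j

/-- **Kriz–Li 2019, §6 Table 2, row `92a1`** (verbatim in the module docstring: `92a1 | d_K = −7 |
c₂(E) = 3 | ★ ✓`; Example 6.5): for every imaginary quadratic field `K` of discriminant `−7`, the optimal
curve `92a1` on its (globally minimal) model `[0,1,0,2,1]` admits an OPTIMAL modular parametrisation datum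
`Dt` at level `N(E)`, a Heegner datum `H` of discriminant `d_K` and level `N(E)`, an embedding `ι : K → ℂ`,
a point `P ∈ E(K)` mapping to `heegnerPointComplex Dt H`, and `j : K → ℚ₂` with Assumption (★)
`AssumptionStar E Dt K P j` — the hypotheses of `thm112_bsdTwo_twist` at `W = [0,1,0,2,1]`. Statement only;
TABLE entry in a refereed paper; no `_holds` expected.
[cite: KrizLi2019, §6 Table 2 (row 92a1) and Example 6.5 (FMS 7 (2019) e15, chunk p0018 L17; arXiv:1606.03172v3 Congruence.tex ll. 1037, 1047)] -/
def table2_row92a1 : Prop :=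
  ∀ [(⟨0, 1, 0, 2, 1⟩ : WeierstrassCurve ℚ).IsGloballyMinimal]
    (K : Type) [Field K] [NumberField K], IsImaginaryQuadratic K → NumberField.discr K = -7 →
    ∃ (_ : NeZero ((⟨0, 1, 0, 2, 1⟩ : WeierstrassCurve ℚ).conductorNorm ℤ))
      (Dt : ModularParametrizationData (⟨0, 1, 0, 2, 1⟩ : WeierstrassCurve ℚ)
        ((⟨0, 1, 0, 2, 1⟩ : WeierstrassCurve ℚ).conductorNorm ℤ))
      (H : HeegnerDatum ((⟨0, 1, 0, 2, 1⟩ : WeierstrassCurve ℚ).conductorNorm ℤ) (NumberField.discr K))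
      (ι : K →+* ℂ) (P : ((⟨0, 1, 0, 2, 1⟩ : WeierstrassCurve ℚ).baseChange K).toAffine.Point)
      (j : K →ₐ[ℚ] ℚ_[2]),
      Zhai2021.IsOptimalDatum (⟨0, 1, 0, 2, 1⟩ : WeierstrassCurve ℚ) Dt ∧
        WeierstrassCurve.Affine.Point.map ι.toRatAlgHom P = heegnerPointComplex Dt H ∧
          AssumptionStar (⟨0, 1, 0, 2, 1⟩ : WeierstrassCurve ℚ) Dt K P j

end Literature.NumberTheory.EllipticCurves.KrizLi2019

end
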